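import Summits.ABC.IUTFork.Cor312HullVolumeDHVolScaled
import Summits.ABC.IUTFork.Cor312PilotIdelesPr
import HarnessLib

/-!
# [IUTchIII] Cor. 3.12, statement — the LOCAL Θ-VOLUME `−|log(Θ)|_{j,p}` of the PRINT-NORMALISED sharp setting of
# record `Real.settingPrVolSharp` at every odd prime `p ∤ disc(F)`, in CLOSED FORM:
# `−|log(Θ)|_{i+1,p} = −(Σ_{v⃗} Pr(v⃗)·min_a ord_p(t_{Θ,i+1,v_a}))·log p` — the exact (Ind1)/(Ind2)-hull value, not a bound

PROOF-ONLY sequel (abc-iut cell, Cor. 3.12 sub-crew, seat abc-iut-c312-5, gen 5) of this seat's gen-4 files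
`Cor312HullStableDHVol` (p429612) / `Cor312HullVolumeDHVolScaled` (p429931); TAKES NO SIDE on [IUTchIII] Cor. 3.12; no
definition, no `Prop` fact, no instance. Those files COMPUTED, at abc-iut-c312-3's sharp setting `Real.settingDHVolSharp`
(Θ-boxes `ι_j(t_{Θ,j,v_j})·(R_I)^∼` read off Θ-pilot ideles, Dupuy–Hilado §3.9) and a packet `(i+1, p)`, `p` odd,
`p ∤ disc(F)`, the holomorphic hull of the union of ALL possible images ([IUTchIII] Cor. 3.12, kurims
`paper:url-4b091feeb646` p. 174 l. 50 – p. 175 l. 1): `^{n,∘}𝒰_{i+1,p} = e⁻¹(Π_{v⃗} p^{min_a m(v_a)}·I_{v⃗})`,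
`‖t_{Θ,i+1,v}‖ = ‖p^{m(v)}‖`, and its log-volume in the CONSTANT-weight container (normalisation caveat F-c312-1-g5-1).
THIS FILE moves the computation to the PRINT-NORMALISED twin `Real.settingPrVolSharp` (abc-iut-c312-7 p422627: same
frames, comparison, Θ-boxes and indeterminacy orbit over abc-iut-c312-1's probability-weighted container
`summandPiecesPr`, `Pr(v⃗) = Π_a n_{v_a}/[F:ℚ]^{j+1}`, Dupuy–Hilado §3.6 / [IUTchIII] Rmk. 3.1.1 (ii) p. 94), where the
volume NUMBERS of Cor. 3.12 are to be read (plan/C312-RESIDUALS §0):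
* §1 `thetaHull_settingPrVolSharp_eq_settingDHVolSharp` (`rfl`): the set-level objects of the two sharp settings
  coincide (the hull frame and the (Ind1)/(Ind2)-orbit do not read the weights; so does `HullDefined`, `Iff.rfl`);
* §2 `thetaHull_settingPrVolSharp_eq_of_zpow` (`= e⁻¹(Π_{v⃗} p^{min_a m(v_a)}·I_{v⃗})`), one-set stability `hst`
  (abc-iut-w5-d060 p424693) `stable_thetaHull_settingPrVolSharp_of_not_dvd` for ARBITRARY non-zero Θ-ideles,
  `hullDefined_settingPrVolSharp_of_not_dvd`;
* §3 `logvol_latticePkS_ppow_settingPrVol` (`μ^log_{Pr}(e⁻¹(Π p^{k(v⃗)}·I_{v⃗})) = Σ_{v⃗} Pr(v⃗)·(−k(v⃗)·log p)`) and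
  **`thetaLocal_settingPrVolSharp_eq_of_zpow`**: `−|log(Θ)|_{i+1,p} = Σ_{v⃗} Pr(v⃗)·(−min_a m(v_a)·log p)` — the `λ_min`
  form of plan/c312/STEPV-IND1-NOTE.md §2 (abc-iut-c312-d1) as an EXACT kernel value at the real setting;
* §4 the HULL GAIN over the region's own volume (abc-iut-c312-7 `logvol_thetaRegion3_sharp_Pr_inr` =
  `Σ_{v⃗} Pr(v⃗)·log ‖t_{Θ,i+1,v_{i+1}}‖`): `thetaLocal_untopD_sub_logvol_thetaRegion3_sharp_Pr` =
  `Σ_{v⃗} Pr(v⃗)·(m(v_{i+1}) − min_a m(v_a))·log p ≥ 0`, and NO hull gain when `m` is CONSTANT on the places of `F`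
  over `p` (`thetaLocal_settingPrVolSharp_eq_of_const` = `−m·log p`; `…_eq_logvol_thetaRegion3_of_const`), in particular
  when `F` has ONE place over `p` (`…_of_subsingleton`; for `F = ℚ`: every odd prime).
Packets over `2·disc(F)` are NOT treated here (containers: abc-iut-w4-d107 `Cor312NegLogThetaUpperPrVol*`, abc-iut-w5-d082
HULLGLUED-CONTAINER); `∞`: trivial container. [claim: Mochizuki2012, status: disputed] for the quoted quantities;
[cite: DupuyHilado2025, §3.6, §3.9, Rmk. 3.5.4, §4.7, §4.9]; [cite: Mochizuki2012, IUTchIII Rmk. 3.1.1 (ii) p. 94];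
[cite: Mochizuki2012, IUTchIV Thm 1.10 proof Step (v)–(vi) pp. 27–29]. Deliberately NOT here: the global sum, any judgement.
-/

noncomputable section

open Set Function NumberField IsDedekindDomain
open scoped Pointwise

namespace Summit.ABC

namespace IUTFork

namespace Thm311

namespace Real

open Cor312 Cor312Vol Literature.IUT.LogThetaLattice Literature.IUT.LogVolume

variable {F : Type} [Field F] [NumberField F] (X : PilotData F) {logv : PadicLogs F} (hlog : LogvAnalytic logv)

variable (M : Type) [Field M] [NumberField M]
  (archPk : ∀ (j : (thetaIndex X).Label) (vQ : (thetaIndex X).VQ), Set ((logShellsDH X logv).Packet j vQ))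
  (archSub : ∀ (j : (thetaIndex X).Label) (v : (thetaIndex X).V),
    Set ((logShellsDH X logv).Packet j ((thetaIndex X).over v)))
  (Ψ : ℤ → ∀ v : (thetaIndex X).V, v ∈ (thetaIndex X).Vbad → Set ((logShellsDH X logv).StarPacket v))
  (act : ℤ → ∀ v : (thetaIndex X).V, v ∈ (thetaIndex X).Vbad →
    (logShellsDH X logv).StarPacket v → Module.End ℚ ((logShellsDH X logv).StarPacket v))
  (Mmod : ℤ → ∀ j : (thetaIndex X).LabelStar, Set ((logShellsDH X logv).GlobalPacket j.1))
  (region : ℤ → ∀ j : (thetaIndex X).LabelStar, FinDivisor M → ∀ vQ : (thetaIndex X).VQ,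
    Set ((logShellsDH X logv).Packet j.1 vQ))
  (n : ℤ)

/-! ## 3a. The probability-weighted log-volume of a `p`-power scaled lattice -/
/-- **The print-normalised log-volume of a `p`-power scaled lattice**: `μ^log_{Pr}(e⁻¹(Π_{v⃗} p^{k(v⃗)}·I_{v⃗})) =
Σ_{v⃗} Pr(v⃗)·(−k(v⃗)·log p)` at an unramified odd `p` (`I_{v⃗} = (R_{v⃗})^∼` there; "Mochizuki normalized"
`log μ̄(p^k·(R)^∼) = −k·log p`, weighted by `Pr(v⃗)`) — the twin of this seat's `logvol_latticePkS_ppow_settingDHVol`.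
[cite: DupuyHilado2025, §3.6, Rmk. 3.5.4] -/
theorem logvol_latticePkS_ppow_settingPrVol (i : Fin (thetaIndex X).lstar) (pp : Nat.Primes) [Fact (pp : ℕ).Prime]
    (hp2 : 2 < (pp : ℕ)) (hdisc : ¬ ((pp : ℕ) : ℤ) ∣ NumberField.discr F)
    (k : ((thetaIndex X).Caps (Setting.labelSucc i) → (thetaIndex X).Fibre (.inr pp)) → ℤ) :
    ((situationPrVol X hlog M archPk archSub Ψ act Mmod region).D n).logvol (Setting.labelSucc i) (.inr pp)
        ((presAt X hlog pp).latticePkS (Setting.labelSucc i) fun e => ((pp : ℕ) : ℚ_[pp]) ^ k e) =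
      ∑ e : (presAt X hlog pp).toLocalPieces.E (Setting.labelSucc i),
        weightPr X pp.1 (Setting.labelSucc i) e * (-(k e * Real.log (pp : ℕ))) := by
  have hj := two_le_card_caps_labelSucc X i
  have he := absRamificationIdx_presAt_eq_one X hlog pp hdisc
  rw [(presAt X hlog pp).latticePkS_eq_of_unramified hp2 hj he]
  have hadm : ∀ e : (thetaIndex X).Caps (Setting.labelSucc i) → (thetaIndex X).Fibre (.inr pp),
      PacketAdm (pp : ℕ) ((presAt X hlog pp).kk e)
        ((((pp : ℕ) : ℚ_[pp]) ^ k e) • (normalizedPacket (pp : ℕ) ((presAt X hlog pp).kk e) :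
          Set ((presAt X hlog pp).X e))) :=
    fun e => packetAdm_const_smul (pp : ℕ) _ (zpow_ne_zero _ (Nat.cast_ne_zero.mpr pp.2.ne_zero))
      (packetAdm_normalizedPacket (pp : ℕ) _)
  have key := SummandPieces.logvol_preimage_pi (summandPiecesPr X hlog) (Setting.labelSucc i) (.inr pp)
    (R := fun e => (((pp : ℕ) : ℚ_[pp]) ^ k e) • (normalizedPacket (pp : ℕ) ((presAt X hlog pp).kk e) :
      Set ((presAt X hlog pp).X e))) hadm
  refine (((realizes_situationPrVol X hlog M archPk archSub Ψ act Mmod region n).logvol_eq _ (.inr pp) _).trans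
    key).trans (Finset.sum_congr rfl fun e _ => ?_)
  haveI : Nonempty ((thetaIndex X).Caps (Setting.labelSucc i)) := ⟨0⟩
  show weightPr X pp.1 (Setting.labelSucc i) e * packetLogμ (pp : ℕ) ((presAt X hlog pp).kk e) _ = _
  congr 1
  rw [smul_set_eq_algebraMap_smul (pp : ℕ) ((presAt X hlog pp).kk e)]
  show packetLogμ (pp : ℕ) ((presAt X hlog pp).kk e)
    (ppow (pp : ℕ) ((presAt X hlog pp).kk e) (k e) • (normalizedPacket (pp : ℕ) ((presAt X hlog pp).kk e) :
      Set ((presAt X hlog pp).X e))) = _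
  rw [packetLogμ_ppow_smul (pp : ℕ) _ (k e) (packetAdm_normalizedPacket (pp : ℕ) _), packetLogμ_normalizedPacket,
    add_zero]

/-- **The probability weights of the `(j+1)`-packet over `p` sum to `1`** (abc-iut-c312-1 `sum_w_summandPiecesPr`). [cite: DupuyHilado2025, §3.6] -/
theorem sum_weightPr_presAt (pp : Nat.Primes) [Fact (pp : ℕ).Prime] (j : (thetaIndex X).Label) :
    ∑ e : (presAt X hlog pp).toLocalPieces.E j, weightPr X pp.1 j e = 1 :=
  sum_w_summandPiecesPr X pp.1 hlog j

section Sharp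

variable (t : ∀ (pp : Nat.Primes) (_ : Fin X.lstar) (x : (thetaIndex X).Fibre (.inr pp)),
    haveI : Fact (pp : ℕ).Prime := ⟨pp.2⟩; kOf X pp.1 x)
  (tq : ∀ (pp : Nat.Primes) (x : (thetaIndex X).Fibre (.inr pp)),
    haveI : Fact (pp : ℕ).Prime := ⟨pp.2⟩; kOf X pp.1 x)
  {HT : Type} {LogLink : HT → HT → Type} {IsFull : ∀ {s t : HT}, LogLink s t → Prop}
  (lat : LGPGaussianLogThetaLattice LogLink IsFull)
  {Frd : Type} {IsoF : Frd → Frd → Type} {Ob : Frd → Type} {realify : Frd → Frd} {Strip : Type}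
  {IsoS : Strip → Strip → Type} {Mv : ∀ v : (thetaIndex X).V, v ∈ (thetaIndex X).Vbad → Type}
  [∀ v h, Monoid (Mv v h)]
  (sig : GlobalLGPFrobenioidSignature (thetaIndex X).lstar (thetaIndex X).V (· ∈ (thetaIndex X).Vbad)
    Frd IsoF Ob realify Strip IsoS Mv)
  (split : SplittingMonoids Mv) {ObΔ : Type} {N : ∀ v : (thetaIndex X).V, v ∈ (thetaIndex X).Vbad → Type}
  [∀ v h, Monoid (N v h)] (qData : QPilotData ObΔ N)

/-! ## 1. The set-level objects of the print-normalised sharp setting ARE those of the sharp DH setting -/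

/-- **`^{n,∘}𝒰_{j,v_ℚ}` of the print-normalised sharp setting IS that of the sharp DH setting** (the hull frame
`HullFrame.ofComparison` and the union of possible images do not read the weights). [folklore] -/
theorem thetaHull_settingPrVolSharp_eq_settingDHVolSharp (htq0 : ∀ pp x, tq pp x ≠ 0)
    (htq1 : ∀ (pp : Nat.Primes) (x : (thetaIndex X).Fibre (.inr pp)),
      haveI : Fact (pp : ℕ).Prime := ⟨pp.2⟩; placeOf X pp.1 x ∉ X.S → ‖tq pp x‖ = 1)
    (j : (thetaIndex X).Label) (vQ : (thetaIndex X).VQ) :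
    (settingPrVolSharp X hlog M archPk archSub Ψ act Mmod region n lat sig split qData tq t htq0
        htq1).thetaHull j vQ =
      (settingDHVolSharp X hlog M archPk archSub Ψ act Mmod region n lat sig split qData tq t htq0
        htq1).thetaHull j vQ :=
  rfl

/-! ## 2. `^{n,∘}𝒰_{i+1,p}` computed, `hst`, `HullDefined` at every odd `p ∤ disc(F)` -/

/-- **At the PRINT-NORMALISED sharp setting of record, at an odd `p ∤ disc(F)` where the Θ-ideles over `p` have norms
`‖t_{Θ,i+1,v}‖ = ‖p^{m(v)}‖`: `^{n,∘}𝒰_{i+1,p} = e⁻¹(Π_{v⃗} p^{min_a m(v_a)}·I_{v⃗})`** — (Ind1) replaces the exponent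
`m(v_{i+1})` of the sharp box by the MINIMUM over the capsule (gen-4 `thetaHull_settingDHVolSharp_eq_of_zpow`, moved
along §1). [cite: DupuyHilado2025, §3.9, §4.7] -/
theorem thetaHull_settingPrVolSharp_eq_of_zpow (ht0 : ∀ pp i x, t pp i x ≠ 0) (htq0 : ∀ pp x, tq pp x ≠ 0)
    (htq1 : ∀ (pp : Nat.Primes) (x : (thetaIndex X).Fibre (.inr pp)),
      haveI : Fact (pp : ℕ).Prime := ⟨pp.2⟩; placeOf X pp.1 x ∉ X.S → ‖tq pp x‖ = 1)
    (i : Fin (thetaIndex X).lstar) (pp : Nat.Primes) [Fact (pp : ℕ).Prime] (hp2 : 2 < (pp : ℕ))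
    (hdisc : ¬ ((pp : ℕ) : ℤ) ∣ NumberField.discr F)
    (m : (thetaIndex X).Fibre (.inr pp) → ℤ) (hm : ∀ x, ‖t pp i x‖ = ‖((pp : ℕ) : ℚ_[pp]) ^ m x‖) :
    (settingPrVolSharp X hlog M archPk archSub Ψ act Mmod region n lat sig split qData tq t htq0
        htq1).thetaHull (Setting.labelSucc i) (.inr pp) =
      (presAt X hlog pp).latticePkS (Setting.labelSucc i) fun e =>
        ((pp : ℕ) : ℚ_[pp]) ^ Finset.univ.inf' Finset.univ_nonempty (fun a => m (e a)) :=
  thetaHull_settingDHVolSharp_eq_of_zpow X hlog t tq M archPk archSub Ψ act Mmod region n lat sig split qData ht0 htq0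
    htq1 i pp hp2 hdisc m hm

/-- **One-set stability `hst` of `^{n,∘}𝒰_{i+1,p}` at the print-normalised sharp setting**, at EVERY odd `p ∤ disc(F)`
and for ARBITRARY non-zero Θ-ideles: every `Φ ∈ indGroup` maps the hull onto itself (gen-4
`stable_thetaHull_settingDHVolSharp_of_unramified`, moved along §1). [cite: DupuyHilado2025, §3.9, §4.7, §4.9] -/
theorem stable_thetaHull_settingPrVolSharp_of_not_dvd (ht0 : ∀ pp i x, t pp i x ≠ 0) (htq0 : ∀ pp x, tq pp x ≠ 0)
    (htq1 : ∀ (pp : Nat.Primes) (x : (thetaIndex X).Fibre (.inr pp)),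
      haveI : Fact (pp : ℕ).Prime := ⟨pp.2⟩; placeOf X pp.1 x ∉ X.S → ‖tq pp x‖ = 1)
    (i : Fin (thetaIndex X).lstar) (pp : Nat.Primes) (hp2 : 2 < (pp : ℕ))
    (hdisc : ¬ ((pp : ℕ) : ℤ) ∣ NumberField.discr F) :
    ∀ Φ ∈ Setting.indGroup (situationPrVol X hlog M archPk archSub Ψ act Mmod region),
      Φ (Setting.labelSucc i) (.inr pp) ''
          (settingPrVolSharp X hlog M archPk archSub Ψ act Mmod region n lat sig split qData tq t htq0
            htq1).thetaHull (Setting.labelSucc i) (.inr pp) =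
        (settingPrVolSharp X hlog M archPk archSub Ψ act Mmod region n lat sig split qData tq t htq0
          htq1).thetaHull (Setting.labelSucc i) (.inr pp) :=
  stable_thetaHull_settingDHVolSharp_of_unramified X hlog t tq M archPk archSub Ψ act Mmod region n lat sig split qData
    ht0 htq0 htq1 i pp hp2 hdisc

/-- `HullDefined` at such a packet of the print-normalised sharp setting. [folklore] -/
theorem hullDefined_settingPrVolSharp_of_not_dvd (ht0 : ∀ pp i x, t pp i x ≠ 0) (htq0 : ∀ pp x, tq pp x ≠ 0)
    (htq1 : ∀ (pp : Nat.Primes) (x : (thetaIndex X).Fibre (.inr pp)),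
      haveI : Fact (pp : ℕ).Prime := ⟨pp.2⟩; placeOf X pp.1 x ∉ X.S → ‖tq pp x‖ = 1)
    (i : Fin (thetaIndex X).lstar) (pp : Nat.Primes) (hdisc : ¬ ((pp : ℕ) : ℤ) ∣ NumberField.discr F) :
    (settingPrVolSharp X hlog M archPk archSub Ψ act Mmod region n lat sig split qData tq t htq0
        htq1).HullDefined (Setting.labelSucc i) (.inr pp) :=
  hullDefined_settingDHVolSharp_of_unramified X hlog t tq M archPk archSub Ψ act Mmod region n lat sig split qData ht0
    htq0 htq1 i pp hdisc

/-! ## 3. The local Θ-volume in closed form -/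

/-- **The local Θ-volume of the PRINT-NORMALISED sharp setting of record at an odd packet `p ∤ disc(F)`, in closed
form**: `−|log(Θ)|_{i+1,p} = Σ_{v⃗} Pr(v⃗)·(−min_a m(v_a)·log p)` when `‖t_{Θ,i+1,v}‖ = ‖p^{m(v)}‖` (automatic at an
unramified place) — the exponent of the Θ-idele at the LAST coordinate of the sharp box is replaced by the MINIMUM over
the capsule (the `λ_min` of plan/c312/STEPV-IND1-NOTE.md §2), weighted by the probability weights of Dupuy–Hilado
§3.6 / [IUTchIII] Rmk. 3.1.1 (ii). [cite: DupuyHilado2025, §3.6, §3.9, Rmk. 3.5.4] -/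
theorem thetaLocal_settingPrVolSharp_eq_of_zpow (ht0 : ∀ pp i x, t pp i x ≠ 0) (htq0 : ∀ pp x, tq pp x ≠ 0)
    (htq1 : ∀ (pp : Nat.Primes) (x : (thetaIndex X).Fibre (.inr pp)),
      haveI : Fact (pp : ℕ).Prime := ⟨pp.2⟩; placeOf X pp.1 x ∉ X.S → ‖tq pp x‖ = 1)
    (i : Fin (thetaIndex X).lstar) (pp : Nat.Primes) [Fact (pp : ℕ).Prime] (hp2 : 2 < (pp : ℕ))
    (hdisc : ¬ ((pp : ℕ) : ℤ) ∣ NumberField.discr F)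
    (m : (thetaIndex X).Fibre (.inr pp) → ℤ) (hm : ∀ x, ‖t pp i x‖ = ‖((pp : ℕ) : ℚ_[pp]) ^ m x‖) :
    (settingPrVolSharp X hlog M archPk archSub Ψ act Mmod region n lat sig split qData tq t htq0
        htq1).thetaLocal (Setting.labelSucc i) (.inr pp) =
      ((∑ e : (presAt X hlog pp).toLocalPieces.E (Setting.labelSucc i),
        weightPr X pp.1 (Setting.labelSucc i) e *
          (-(Finset.univ.inf' Finset.univ_nonempty (fun a => m (e a)) * Real.log (pp : ℕ))) : ℝ) : WithTop ℝ) := by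
  haveI : Nonempty ((thetaIndex X).Caps (Setting.labelSucc i)) := ⟨0⟩
  have hHD := hullDefined_settingPrVolSharp_of_not_dvd X hlog M archPk archSub Ψ act Mmod region n t tq lat sig split
    qData ht0 htq0 htq1 i pp hdisc
  unfold Setting.thetaLocal
  rw [if_pos hHD, thetaHull_settingPrVolSharp_eq_of_zpow X hlog M archPk archSub Ψ act Mmod region n t tq lat sig split
    qData ht0 htq0 htq1 i pp hp2 hdisc m hm]
  congr 1
  have h := logvol_latticePkS_ppow_settingPrVol X hlog M archPk archSub Ψ act Mmod region n i pp hp2 hdisc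
    fun e => Finset.univ.inf' Finset.univ_nonempty fun a => m (e a)
  rw [settingPrVolSharp_n]
  exact h

/-! ## 4. The hull gain over the (Ind3)-region's own volume -/

/-- **Box ≤ hull at such a packet, print-normalised, in numbers**: the (Ind3)-region (the sharp box, exponents
`m(v_{i+1})`, volume abc-iut-c312-7 `logvol_thetaRegion3_sharp_Pr_inr`) has log-volume at most `−|log(Θ)|_{i+1,p}`
(exponents `min_a m(v_a)`). [cite: DupuyHilado2025, §3.9] -/
theorem logvol_thetaRegion3_le_thetaLocal_sharp_Pr (ht0 : ∀ pp i x, t pp i x ≠ 0) (htq0 : ∀ pp x, tq pp x ≠ 0)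
    (htq1 : ∀ (pp : Nat.Primes) (x : (thetaIndex X).Fibre (.inr pp)),
      haveI : Fact (pp : ℕ).Prime := ⟨pp.2⟩; placeOf X pp.1 x ∉ X.S → ‖tq pp x‖ = 1)
    (i : Fin (thetaIndex X).lstar) (pp : Nat.Primes) [Fact (pp : ℕ).Prime] (hp2 : 2 < (pp : ℕ))
    (hdisc : ¬ ((pp : ℕ) : ℤ) ∣ NumberField.discr F)
    (m : (thetaIndex X).Fibre (.inr pp) → ℤ) (hm : ∀ x, ‖t pp i x‖ = ‖((pp : ℕ) : ℚ_[pp]) ^ m x‖) :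
    ((((situationPrVol X hlog M archPk archSub Ψ act Mmod region).D n).logvol (Setting.labelSucc i) (.inr pp)
        ((settingPrVolSharp X hlog M archPk archSub Ψ act Mmod region n lat sig split qData tq t htq0
          htq1).thetaRegion3 (Setting.labelSucc i) (.inr pp)) : ℝ) : WithTop ℝ) ≤
      (settingPrVolSharp X hlog M archPk archSub Ψ act Mmod region n lat sig split qData tq t htq0
        htq1).thetaLocal (Setting.labelSucc i) (.inr pp) := by
  haveI : Nonempty ((thetaIndex X).Caps (Setting.labelSucc i)) := ⟨0⟩
  have hp1 : 0 ≤ Real.log (pp : ℕ) := Real.log_nonneg (by exact_mod_cast pp.2.one_lt.le)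
  rw [thetaLocal_settingPrVolSharp_eq_of_zpow X hlog M archPk archSub Ψ act Mmod region n t tq lat sig split qData ht0
    htq0 htq1 i pp hp2 hdisc m hm, WithTop.coe_le_coe]
  show ((situationPrVol X hlog M archPk archSub Ψ act Mmod region).D n).logvol (Setting.labelSucc i) (.inr pp)
      ((settingPrVol X hlog M archPk archSub Ψ act Mmod region n lat sig split qData
        (fun _ _ => thetaBoxDH X hlog (sharpBoxDH X hlog t)) (fun _ => qCentreDH X hlog tq)
          (qCentreDH_ne_zero X hlog tq htq0)
          (finite_support_logvol_qRegion_Pr X hlog M archPk archSub Ψ act Mmod region n tq htq0 htq1)).thetaRegion3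
        (Setting.labelSucc i) (.inr pp)) ≤ _
  rw [logvol_thetaRegion3_sharp_Pr_inr X hlog M archPk archSub Ψ act Mmod region n lat sig split qData _ _ _ t ht0 i pp]
  refine Finset.sum_le_sum fun e _ => mul_le_mul_of_nonneg_left ?_ (weightPr_nonneg X pp.1 _ e)
  rw [hm, norm_zpow, Padic.norm_p, Real.log_zpow, Real.log_inv, mul_neg]
  exact neg_le_neg (mul_le_mul_of_nonneg_right
    (by exact_mod_cast Finset.inf'_le (fun a => m (e a)) (Finset.mem_univ (Fin.last _))) hp1)

/-- **The HULL GAIN in closed form**: `−|log(Θ)|_{i+1,p} − μ^log_{Pr}((Ind3)-region_{i+1,p}) =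
Σ_{v⃗} Pr(v⃗)·(m(v_{i+1}) − min_a m(v_a))·log p` — the amount by which the (Ind1)/(Ind2)-hull raises the local Θ-volume
above the sharp region's own at an odd packet `p ∤ disc(F)` of the print-normalised setting of record: the slot-minimum
effect of plan/c312/STEPV-IND1-NOTE.md §2, exactly. [cite: DupuyHilado2025, §3.6, §3.9, §4.7] -/
theorem thetaLocal_untopD_sub_logvol_thetaRegion3_sharp_Pr (ht0 : ∀ pp i x, t pp i x ≠ 0)
    (htq0 : ∀ pp x, tq pp x ≠ 0)
    (htq1 : ∀ (pp : Nat.Primes) (x : (thetaIndex X).Fibre (.inr pp)),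
      haveI : Fact (pp : ℕ).Prime := ⟨pp.2⟩; placeOf X pp.1 x ∉ X.S → ‖tq pp x‖ = 1)
    (i : Fin (thetaIndex X).lstar) (pp : Nat.Primes) [Fact (pp : ℕ).Prime] (hp2 : 2 < (pp : ℕ))
    (hdisc : ¬ ((pp : ℕ) : ℤ) ∣ NumberField.discr F)
    (m : (thetaIndex X).Fibre (.inr pp) → ℤ) (hm : ∀ x, ‖t pp i x‖ = ‖((pp : ℕ) : ℚ_[pp]) ^ m x‖) :
    ((settingPrVolSharp X hlog M archPk archSub Ψ act Mmod region n lat sig split qData tq t htq0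
        htq1).thetaLocal (Setting.labelSucc i) (.inr pp)).untopD 0 -
      ((situationPrVol X hlog M archPk archSub Ψ act Mmod region).D n).logvol (Setting.labelSucc i) (.inr pp)
        ((settingPrVolSharp X hlog M archPk archSub Ψ act Mmod region n lat sig split qData tq t htq0
          htq1).thetaRegion3 (Setting.labelSucc i) (.inr pp)) =
      ∑ e : (presAt X hlog pp).toLocalPieces.E (Setting.labelSucc i),
        weightPr X pp.1 (Setting.labelSucc i) e *
          ((m (e (Fin.last _)) - Finset.univ.inf' Finset.univ_nonempty (fun a => m (e a))) * Real.log (pp : ℕ)) := by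
  haveI : Nonempty ((thetaIndex X).Caps (Setting.labelSucc i)) := ⟨0⟩
  rw [thetaLocal_settingPrVolSharp_eq_of_zpow X hlog M archPk archSub Ψ act Mmod region n t tq lat sig split qData ht0
    htq0 htq1 i pp hp2 hdisc m hm, WithTop.untopD_coe]
  show _ - ((situationPrVol X hlog M archPk archSub Ψ act Mmod region).D n).logvol (Setting.labelSucc i) (.inr pp)
      ((settingPrVol X hlog M archPk archSub Ψ act Mmod region n lat sig split qData
        (fun _ _ => thetaBoxDH X hlog (sharpBoxDH X hlog t)) (fun _ => qCentreDH X hlog tq)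
          (qCentreDH_ne_zero X hlog tq htq0)
          (finite_support_logvol_qRegion_Pr X hlog M archPk archSub Ψ act Mmod region n tq htq0 htq1)).thetaRegion3
        (Setting.labelSucc i) (.inr pp)) = _
  rw [logvol_thetaRegion3_sharp_Pr_inr X hlog M archPk archSub Ψ act Mmod region n lat sig split qData _ _ _ t ht0 i pp,
    ← Finset.sum_sub_distrib]
  refine Finset.sum_congr rfl fun e _ => ?_
  rw [hm, norm_zpow, Padic.norm_p, Real.log_zpow, Real.log_inv]
  ring

/-- **The hull gain is non-negative**: `0 ≤ −|log(Θ)|_{i+1,p} − μ^log_{Pr}((Ind3)-region_{i+1,p})`. [cite: DupuyHilado2025, §3.9] -/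
theorem thetaLocal_untopD_sub_logvol_thetaRegion3_sharp_Pr_nonneg (ht0 : ∀ pp i x, t pp i x ≠ 0)
    (htq0 : ∀ pp x, tq pp x ≠ 0)
    (htq1 : ∀ (pp : Nat.Primes) (x : (thetaIndex X).Fibre (.inr pp)),
      haveI : Fact (pp : ℕ).Prime := ⟨pp.2⟩; placeOf X pp.1 x ∉ X.S → ‖tq pp x‖ = 1)
    (i : Fin (thetaIndex X).lstar) (pp : Nat.Primes) [Fact (pp : ℕ).Prime] (hp2 : 2 < (pp : ℕ))
    (hdisc : ¬ ((pp : ℕ) : ℤ) ∣ NumberField.discr F) :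
    0 ≤ ((settingPrVolSharp X hlog M archPk archSub Ψ act Mmod region n lat sig split qData tq t htq0
        htq1).thetaLocal (Setting.labelSucc i) (.inr pp)).untopD 0 -
      ((situationPrVol X hlog M archPk archSub Ψ act Mmod region).D n).logvol (Setting.labelSucc i) (.inr pp)
        ((settingPrVolSharp X hlog M archPk archSub Ψ act Mmod region n lat sig split qData tq t htq0
          htq1).thetaRegion3 (Setting.labelSucc i) (.inr pp)) := by
  have he := absRamificationIdx_presAt_eq_one X hlog pp hdisc
  choose m hm using fun x : (thetaIndex X).Fibre (.inr pp) =>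
    exists_norm_eq_norm_padic_zpow (pp : ℕ) ((presAt X hlog pp).k x) (he x) (ht0 pp i x)
  haveI : Nonempty ((thetaIndex X).Caps (Setting.labelSucc i)) := ⟨0⟩
  have hp1 : 0 ≤ Real.log (pp : ℕ) := Real.log_nonneg (by exact_mod_cast pp.2.one_lt.le)
  rw [thetaLocal_untopD_sub_logvol_thetaRegion3_sharp_Pr X hlog M archPk archSub Ψ act Mmod region n t tq lat sig split
    qData ht0 htq0 htq1 i pp hp2 hdisc m hm]
  refine Finset.sum_nonneg fun e _ => mul_nonneg (weightPr_nonneg X pp.1 _ e) (mul_nonneg ?_ hp1)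
  rw [sub_nonneg]
  exact_mod_cast Finset.inf'_le (fun a => m (e a)) (Finset.mem_univ (Fin.last _))

/-- **No hull gain when the Θ-order is CONSTANT on the places of `F` over `p`**: if `‖t_{Θ,i+1,v}‖ = ‖p^{m₀}‖` for every
`v | p`, then `−|log(Θ)|_{i+1,p} = −m₀·log p` (the probability weights sum to `1`), i.e. the (Ind3)-region's own volume
— the case "`V(F_mod)_p` a singleton / slot-constant orders" of plan/c312/STEPV-IND1-NOTE.md §2 in which the (Ind1)
symmetrisation is void. [cite: DupuyHilado2025, §3.6, §3.9] -/
theorem thetaLocal_settingPrVolSharp_eq_of_const (ht0 : ∀ pp i x, t pp i x ≠ 0) (htq0 : ∀ pp x, tq pp x ≠ 0)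
    (htq1 : ∀ (pp : Nat.Primes) (x : (thetaIndex X).Fibre (.inr pp)),
      haveI : Fact (pp : ℕ).Prime := ⟨pp.2⟩; placeOf X pp.1 x ∉ X.S → ‖tq pp x‖ = 1)
    (i : Fin (thetaIndex X).lstar) (pp : Nat.Primes) [Fact (pp : ℕ).Prime] (hp2 : 2 < (pp : ℕ))
    (hdisc : ¬ ((pp : ℕ) : ℤ) ∣ NumberField.discr F)
    (m₀ : ℤ) (hm : ∀ x : (thetaIndex X).Fibre (.inr pp), ‖t pp i x‖ = ‖((pp : ℕ) : ℚ_[pp]) ^ m₀‖) :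
    (settingPrVolSharp X hlog M archPk archSub Ψ act Mmod region n lat sig split qData tq t htq0
        htq1).thetaLocal (Setting.labelSucc i) (.inr pp) = ((-(m₀ * Real.log (pp : ℕ)) : ℝ) : WithTop ℝ) := by
  haveI : Nonempty ((thetaIndex X).Caps (Setting.labelSucc i)) := ⟨0⟩
  rw [thetaLocal_settingPrVolSharp_eq_of_zpow X hlog M archPk archSub Ψ act Mmod region n t tq lat sig split qData ht0
    htq0 htq1 i pp hp2 hdisc (fun _ => m₀) hm]
  congr 1
  simp only [Finset.inf'_const, ← Finset.sum_mul, sum_weightPr_presAt X hlog pp, one_mul]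

/-- **… equivalently, `−|log(Θ)|_{i+1,p}` IS the (Ind3)-region's own log-volume there** (no hull gain; abc-iut-c312-7
`logvol_thetaRegion3_sharp_Pr_inr`). [cite: DupuyHilado2025, §3.6, §3.9] -/
theorem thetaLocal_settingPrVolSharp_eq_logvol_thetaRegion3_of_const (ht0 : ∀ pp i x, t pp i x ≠ 0)
    (htq0 : ∀ pp x, tq pp x ≠ 0)
    (htq1 : ∀ (pp : Nat.Primes) (x : (thetaIndex X).Fibre (.inr pp)),
      haveI : Fact (pp : ℕ).Prime := ⟨pp.2⟩; placeOf X pp.1 x ∉ X.S → ‖tq pp x‖ = 1)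
    (i : Fin (thetaIndex X).lstar) (pp : Nat.Primes) [Fact (pp : ℕ).Prime] (hp2 : 2 < (pp : ℕ))
    (hdisc : ¬ ((pp : ℕ) : ℤ) ∣ NumberField.discr F)
    (m₀ : ℤ) (hm : ∀ x : (thetaIndex X).Fibre (.inr pp), ‖t pp i x‖ = ‖((pp : ℕ) : ℚ_[pp]) ^ m₀‖) :
    (settingPrVolSharp X hlog M archPk archSub Ψ act Mmod region n lat sig split qData tq t htq0
        htq1).thetaLocal (Setting.labelSucc i) (.inr pp) =
      ((((situationPrVol X hlog M archPk archSub Ψ act Mmod region).D n).logvol (Setting.labelSucc i) (.inr pp)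
        ((settingPrVolSharp X hlog M archPk archSub Ψ act Mmod region n lat sig split qData tq t htq0
          htq1).thetaRegion3 (Setting.labelSucc i) (.inr pp)) : ℝ) : WithTop ℝ) := by
  haveI : Nonempty ((thetaIndex X).Caps (Setting.labelSucc i)) := ⟨0⟩
  rw [thetaLocal_settingPrVolSharp_eq_of_const X hlog M archPk archSub Ψ act Mmod region n t tq lat sig split qData ht0
    htq0 htq1 i pp hp2 hdisc m₀ hm]
  congr 1
  show _ = ((situationPrVol X hlog M archPk archSub Ψ act Mmod region).D n).logvol (Setting.labelSucc i) (.inr pp)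
      ((settingPrVol X hlog M archPk archSub Ψ act Mmod region n lat sig split qData
        (fun _ _ => thetaBoxDH X hlog (sharpBoxDH X hlog t)) (fun _ => qCentreDH X hlog tq)
          (qCentreDH_ne_zero X hlog tq htq0)
          (finite_support_logvol_qRegion_Pr X hlog M archPk archSub Ψ act Mmod region n tq htq0 htq1)).thetaRegion3
        (Setting.labelSucc i) (.inr pp))
  rw [logvol_thetaRegion3_sharp_Pr_inr X hlog M archPk archSub Ψ act Mmod region n lat sig split qData _ _ _ t ht0 i pp]
  simp_rw [hm, norm_zpow, Padic.norm_p, Real.log_zpow, Real.log_inv, ← Finset.sum_mul, sum_weightPr_presAt X hlog pp]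
  ring

/-- **ONE place of `F` over `p` ⇒ no hull gain**: if the fibre of `𝕍(F) → 𝕍(ℚ)` over the odd prime `p ∤ disc(F)` is a
subsingleton, then at every label `i+1` the local Θ-volume of the print-normalised sharp setting of record IS the
(Ind3)-region's own log-volume, for ARBITRARY non-zero Θ-ideles (the exponent is then constant on the fibre). For
`F = ℚ` this is every odd prime. [cite: DupuyHilado2025, §3.6, §3.9] -/
theorem thetaLocal_settingPrVolSharp_eq_logvol_thetaRegion3_of_subsingleton (ht0 : ∀ pp i x, t pp i x ≠ 0)
    (htq0 : ∀ pp x, tq pp x ≠ 0)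
    (htq1 : ∀ (pp : Nat.Primes) (x : (thetaIndex X).Fibre (.inr pp)),
      haveI : Fact (pp : ℕ).Prime := ⟨pp.2⟩; placeOf X pp.1 x ∉ X.S → ‖tq pp x‖ = 1)
    (i : Fin (thetaIndex X).lstar) (pp : Nat.Primes) [Fact (pp : ℕ).Prime] (hp2 : 2 < (pp : ℕ))
    (hdisc : ¬ ((pp : ℕ) : ℤ) ∣ NumberField.discr F) [Subsingleton ((thetaIndex X).Fibre (.inr pp))] :
    (settingPrVolSharp X hlog M archPk archSub Ψ act Mmod region n lat sig split qData tq t htq0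
        htq1).thetaLocal (Setting.labelSucc i) (.inr pp) =
      ((((situationPrVol X hlog M archPk archSub Ψ act Mmod region).D n).logvol (Setting.labelSucc i) (.inr pp)
        ((settingPrVolSharp X hlog M archPk archSub Ψ act Mmod region n lat sig split qData tq t htq0
          htq1).thetaRegion3 (Setting.labelSucc i) (.inr pp)) : ℝ) : WithTop ℝ) := by
  have he := absRamificationIdx_presAt_eq_one X hlog pp hdisc
  choose m hm using fun x : (thetaIndex X).Fibre (.inr pp) =>
    exists_norm_eq_norm_padic_zpow (pp : ℕ) ((presAt X hlog pp).k x) (he x) (ht0 pp i x)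
  have hm' : ∀ x : (thetaIndex X).Fibre (.inr pp), ‖t pp i x‖ = ‖((pp : ℕ) : ℚ_[pp]) ^ m x‖ := hm
  haveI : Nonempty ((thetaIndex X).Caps (Setting.labelSucc i)) := ⟨0⟩
  rw [thetaLocal_settingPrVolSharp_eq_of_zpow X hlog M archPk archSub Ψ act Mmod region n t tq lat sig split qData ht0
    htq0 htq1 i pp hp2 hdisc m hm']
  congr 1
  show _ = ((situationPrVol X hlog M archPk archSub Ψ act Mmod region).D n).logvol (Setting.labelSucc i) (.inr pp)
      ((settingPrVol X hlog M archPk archSub Ψ act Mmod region n lat sig split qData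
        (fun _ _ => thetaBoxDH X hlog (sharpBoxDH X hlog t)) (fun _ => qCentreDH X hlog tq)
          (qCentreDH_ne_zero X hlog tq htq0)
          (finite_support_logvol_qRegion_Pr X hlog M archPk archSub Ψ act Mmod region n tq htq0 htq1)).thetaRegion3
        (Setting.labelSucc i) (.inr pp))
  rw [logvol_thetaRegion3_sharp_Pr_inr X hlog M archPk archSub Ψ act Mmod region n lat sig split qData _ _ _ t ht0 i pp]
  refine Finset.sum_congr rfl fun e _ => ?_
  -- on a subsingleton fibre the exponent is constant along the capsule: `min_a m(v_a) = m(v_{i+1})`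
  have hconst : (fun a => m (e a)) = fun _ => m (e (Fin.last _)) :=
    funext fun a => by rw [Subsingleton.elim (e a) (e (Fin.last _))]
  rw [hconst, Finset.inf'_const, hm', norm_zpow, Padic.norm_p, Real.log_zpow, Real.log_inv]
  ring

end Sharp

end Real

end Thm311

end IUTFork

end Summit.ABC

end
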